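import Literature.AlgebraicGeometry.Resolution.IntegralClosureEssFiniteType
import Literature.AlgebraicGeometry.Resolution.NormalBirationalQuasiFinite
import Literature.RingTheory.KrullDimension.AffineCatenary
import Summits.ResolutionOfSingularities.ResolutionOfSingularities.Theorems.HilbertSamuelEliminationCampaignW42NearAlignment
import Mathlib.RingTheory.AlgebraicIndependent.TranscendenceBasis
import Mathlib.RingTheory.Ideal.Height
import Mathlib.RingTheory.LocalRing.ResidueField.Basic
import HarnessLib

/-!
# Steer σ-residual, LOW half — D3a piece (A4): the transcendence degree of the residue field at the critical prime
# (`trdeg_k κ(P₀) = dim R − ht P₀ = 4 − 2 = 2`, unchanged under the algebraic extension `L = κ(P₀)(√h̄₀)`)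

OURS (campaign res-hironaka, rung L, slot W4.1, crux `Steer` stmt-ResolutionOfSingularities-16345; res-L0-w41-plan-1
RULING 42 (42c) «(A4) `L := κ(P₀)(√h₀)` + `Algebra.trdeg k L = 2` := res-type-026»; consumer res-D-pv-012 AS res-L0-w41-stub-8,
D3a `LowTowerExistsTwo` over `…LowTowerMoves` p517043 / `…LowTowerTorsor` p517570 / `…LowTowerFrame` p518170). Theses-free,
definition-free. AI-produced; weaker than expert review; nothing here is a statement of the manuscript under review.

ENGINE (the dimension formula for local rings essentially of finite type over a field, Matsumura Thm 5.6 / §15 Thm 15.5–15.6 with a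
field as base): for a LOCAL DOMAIN `S` essentially of finite type over a field `k`, with fraction field `F` and residue field
`κ(S)`,
  `trdeg_k F = dim S + trdeg_k κ(S)`                                                     (`exists_trdeg_eq_ringKrullDim_add_trdeg_residueField`).
Proof: `S = C_Q` for the finite-type subalgebra `C = k[σ] ⊆ S` of which `S` is a localisation (Mathlib
`Algebra.EssFiniteType.subalgebra`, tree `isLocalization_atPrime_comap_maximalIdeal`) and `Q = 𝔪_S ∩ C`; `dim S = ht Q`
(Mathlib `IsLocalization.AtPrime.ringKrullDim_eq_height`); `Frac C = F` (tree `isFractionRing_subalgebra_of_isLocalization`) so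
`trdeg_k F = trdeg_k C = dim C`; `κ(S) = Frac (C/Q)` so `trdeg_k κ(S) = trdeg_k (C/Q) = dim C/Q`; and `dim C/Q + ht Q = dim C`
(affine domains are catenary, tree `ringKrullDim_quotient_add_height`).

COROLLARIES: `trdeg_eq_of_ringKrullDim_eq_of_isAlgebraic_residueField` (residue field algebraic ⇒ `trdeg_k F = dim S`);
`exists_trdeg_residueField_add_height_eq` (at a prime `P` of an essentially-finite-type domain `R`: `trdeg_k κ(R_P) + ht P =
trdeg_k F`); `trdeg_residueField_atPrime_eq` (`R` local with algebraic residue field, `dim R = d`, `ht P = h` ⇒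
`trdeg_k κ(R_P) = d − h`); `trdeg_eq_trdeg_of_isAlgebraic` (algebraic field extensions do not change `trdeg_k`);
**`trdeg_eq_two_of_height_two`** — the (A4) number: `dim R = 4`, `ht P₀ = 2`, `L` algebraic over `κ(R_{P₀})` ⇒ `trdeg_k L = 2`.
-/

noncomputable section

-- single-problem summit: the doubled namespace component `ResolutionOfSingularities` is forced
set_option linter.dupNamespace false

namespace Summit.ResolutionOfSingularities.ResolutionOfSingularities.Theorems.SwitchingDichotomy.LowTower

open IsLocalRing
open Literature.AlgebraicGeometry.Resolution

universe u

/-! ## The dimension formula for a local domain essentially of finite type over a field -/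

section Engine

variable {k S F : Type u} [Field k] [CommRing S] [IsDomain S] [IsLocalRing S] [Algebra k S]
  [Algebra.EssFiniteType k S] [Field F] [Algebra S F] [IsFractionRing S F] [Algebra k F] [IsScalarTower k S F]

/-- **Dimension formula for a local domain essentially of finite type over a field.** For a local domain `S` essentially of
finite type over a field `k`, with fraction field `F` and residue field `κ(S)`: there are natural numbers `n, e` with
`trdeg_k F = n`, `dim S = e` and `trdeg_k κ(S) + e = n` — i.e. `trdeg_k Frac S = dim S + trdeg_k κ(S)`.  (`S = C_Q` for a
finite-type `C = k[σ] ⊆ S` and `Q = 𝔪_S ∩ C`; `dim S = ht Q`, `Frac C = F`, `κ(S) = Frac(C/Q)`, and `dim C/Q + ht Q = dim C = trdeg_k C`.)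
[cite: Matsumura1987, Thm 5.6] [cite: Matsumura1987, §15 Thm 15.5–15.6 (dimension formula)] -/
theorem exists_trdeg_eq_ringKrullDim_add_trdeg_residueField :
    ∃ n e : ℕ, Algebra.trdeg k F = n ∧ ringKrullDim S = e ∧ Algebra.trdeg k (ResidueField S) + e = n := by
  classical
  -- the finite-type model `C ⊆ S` and the prime `Q = 𝔪_S ∩ C`, `S = C_Q`
  set C : Subalgebra k S := Algebra.EssFiniteType.subalgebra k S with hCdef
  set Q : Ideal C := (maximalIdeal S).comap (algebraMap C S) with hQdef
  haveI hSQ : IsLocalization.AtPrime S Q := isLocalization_atPrime_comap_maximalIdeal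
  have hdimS : ringKrullDim S = Q.height := IsLocalization.AtPrime.ringKrullDim_eq_height Q S
  -- `C` is an affine domain with `Frac C = F`: `dim C = trdeg_k C = trdeg_k F = n`
  haveI : IsScalarTower C S F := IsScalarTower.of_algebraMap_eq fun _ => rfl
  haveI : IsFractionRing C F := isFractionRing_subalgebra_of_isLocalization k S F
  obtain ⟨n, hnC, hntr⟩ := Literature.RingTheory.KrullDimension.exists_ringKrullDim_eq_and_trdeg_eq k C
  have hnF : Algebra.trdeg k F = n := by
    haveI : Algebra.IsAlgebraic C F := IsLocalization.isAlgebraic F (nonZeroDivisors C)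
    haveI : FaithfulSMul C F :=
      (faithfulSMul_iff_algebraMap_injective C F).mpr (IsFractionRing.injective C F)
    haveI : FaithfulSMul k C := (faithfulSMul_iff_algebraMap_injective k C).mpr (algebraMap k C).injective
    haveI : IsScalarTower k C F := IsScalarTower.of_algebraMap_eq fun c => by
      rw [IsScalarTower.algebraMap_apply k S F, IsScalarTower.algebraMap_apply C S F,
        ← IsScalarTower.algebraMap_apply k C S]
    rw [← trdeg_add_eq k C (A := F), trdeg_eq_zero (R := C) (A := F), add_zero, hntr]
  -- `C/Q` is an affine domain: `dim C/Q = trdeg_k (C/Q) = m`, and `m + ht Q = n`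
  haveI : IsDomain (C ⧸ Q) := Ideal.Quotient.isDomain Q
  haveI : Algebra.FiniteType k (C ⧸ Q) :=
    Algebra.FiniteType.of_surjective (Ideal.Quotient.mkₐ k Q) (Ideal.Quotient.mkₐ_surjective k Q)
  obtain ⟨m, hmC, hmtr⟩ := Literature.RingTheory.KrullDimension.exists_ringKrullDim_eq_and_trdeg_eq k (C ⧸ Q)
  have hform := Literature.RingTheory.KrullDimension.ringKrullDim_quotient_add_height k Q
  rw [hmC, hnC] at hform
  have hle : (Q.height : WithBot ℕ∞) ≤ n := by
    rw [← hnC]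
    exact Ideal.height_le_ringKrullDim_of_ne_top (Ideal.IsPrime.ne_top inferInstance)
  have hle' : Q.height ≤ n := by exact_mod_cast hle
  obtain ⟨e, he⟩ := ENat.ne_top_iff_exists.1 (ne_top_of_le_ne_top (ENat.coe_ne_top n) hle')
  rw [← he] at hform hdimS
  have hme : m + e = n := by exact_mod_cast hform
  refine ⟨n, e, hnF, hdimS, ?_⟩
  -- `κ(S) = κ(C_Q)` is algebraic over `C/Q`: `trdeg_k κ(S) = trdeg_k (C/Q) = m`
  let α : (C ⧸ Q) →ₐ[k] ResidueField S := Ideal.quotientMapₐ (maximalIdeal S) C.val le_rfl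
  letI : Algebra (C ⧸ Q) (ResidueField S) := α.toRingHom.toAlgebra
  haveI : IsScalarTower k (C ⧸ Q) (ResidueField S) :=
    IsScalarTower.of_algebraMap_eq fun c => (α.commutes c).symm
  have h := CampaignW42.trdeg_residueField_eq_of_isLocalization_atPrime (k := k) Q (O' := S) fun a => rfl
  rw [h, hmtr]
  exact_mod_cast hme


/-- **Residue field algebraic ⇒ `trdeg_k Frac S = dim S`.** For a local domain `S` essentially of finite type over `k` whose
residue field is algebraic over `k` (e.g. the local ring of a closed point), `dim S = d` gives `trdeg_k F = d` for the
fraction field `F`. [cite: Matsumura1987, Thm 5.6] -/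
theorem trdeg_eq_of_ringKrullDim_eq_of_isAlgebraic_residueField [Algebra.IsAlgebraic k (ResidueField S)]
    {d : ℕ} (hd : ringKrullDim S = d) : Algebra.trdeg k F = d := by
  obtain ⟨n, e, hn, he, hsum⟩ :=
    exists_trdeg_eq_ringKrullDim_add_trdeg_residueField (k := k) (S := S) (F := F)
  rw [trdeg_eq_zero (R := k) (A := ResidueField S), zero_add] at hsum
  have hen : e = n := by exact_mod_cast hsum
  rw [hd] at he
  have hde : d = e := by exact_mod_cast he
  rw [hn, ← hen, hde]

/-- The same, read the other way: `dim S = trdeg_k F` (a natural number) when the residue field is algebraic over `k`.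
[cite: Matsumura1987, Thm 5.6] -/
theorem ringKrullDim_eq_toNat_trdeg_of_isAlgebraic_residueField [Algebra.IsAlgebraic k (ResidueField S)] :
    ringKrullDim S = (Cardinal.toNat (Algebra.trdeg k F) : WithBot ℕ∞) := by
  obtain ⟨n, e, hn, he, hsum⟩ :=
    exists_trdeg_eq_ringKrullDim_add_trdeg_residueField (k := k) (S := S) (F := F)
  rw [trdeg_eq_zero (R := k) (A := ResidueField S), zero_add] at hsum
  have hen : e = n := by exact_mod_cast hsum
  rw [he, hn, Cardinal.toNat_natCast, hen]

end Engine

/-! ## At a prime: `trdeg_k κ(R_P) + ht P = trdeg_k Frac R` -/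

section AtPrime

variable {k R F Λ : Type u} [Field k] [CommRing R] [IsDomain R] [Algebra k R] [Algebra.EssFiniteType k R]
  [Field F] [Algebra R F] [IsFractionRing R F] [Algebra k F] [IsScalarTower k R F]
  (P : Ideal R) [P.IsPrime] [CommRing Λ] [Algebra R Λ] [IsLocalization.AtPrime Λ P] [IsLocalRing Λ]
  [Algebra k Λ] [IsScalarTower k R Λ]

/-- **`trdeg_k κ(P) + ht P = trdeg_k Frac R`** for a prime `P` of a domain `R` essentially of finite type over a field `k`
(`Λ = R_P` any localisation at `P`, a `k`-algebra through `R`; `κ(P) = κ(Λ)` its residue field): there are natural numbers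
`n, h` with `trdeg_k F = n`, `ht P = h` and `trdeg_k κ(Λ) + h = n` — the engine applied to the local domain `Λ`
(essentially of finite type over `k`, `Frac Λ = F`, `dim Λ = ht P`). [cite: Matsumura1987, §15 Thm 15.5–15.6 (dimension formula)] -/
theorem exists_trdeg_residueField_add_height_eq :
    ∃ n h : ℕ, Algebra.trdeg k F = n ∧ P.height = h ∧ Algebra.trdeg k (ResidueField Λ) + h = n := by
  haveI : IsDomain Λ := IsLocalization.isDomain_of_le_nonZeroDivisors Λ P.primeCompl_le_nonZeroDivisors
  haveI : Algebra.EssFiniteType R Λ := Algebra.EssFiniteType.of_isLocalization Λ P.primeCompl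
  haveI : Algebra.EssFiniteType k Λ := Algebra.EssFiniteType.comp k R Λ
  -- `Λ → F` and `Frac Λ = F`
  have hunit : ∀ y : P.primeCompl, IsUnit (algebraMap R F y) := fun y =>
    IsUnit.mk0 _ ((map_ne_zero_iff _ (IsFractionRing.injective R F)).mpr
      (nonZeroDivisors.ne_zero (P.primeCompl_le_nonZeroDivisors y.2)))
  letI : Algebra Λ F := (IsLocalization.lift (M := P.primeCompl) (S := Λ) hunit).toAlgebra
  haveI : IsScalarTower R Λ F := IsScalarTower.of_algebraMap_eq fun r =>
    (IsLocalization.lift_eq (M := P.primeCompl) (S := Λ) hunit r).symm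
  haveI : IsScalarTower k Λ F := IsScalarTower.of_algebraMap_eq fun c => by
    rw [IsScalarTower.algebraMap_apply k R F, IsScalarTower.algebraMap_apply k R Λ,
      ← IsScalarTower.algebraMap_apply R Λ F]
  haveI : IsFractionRing Λ F :=
    IsFractionRing.isFractionRing_of_isDomain_of_isLocalization P.primeCompl Λ F
  obtain ⟨n, e, hn, he, hsum⟩ :=
    exists_trdeg_eq_ringKrullDim_add_trdeg_residueField (k := k) (S := Λ) (F := F)
  rw [IsLocalization.AtPrime.ringKrullDim_eq_height P Λ] at he
  exact ⟨n, e, hn, by exact_mod_cast he, hsum⟩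

/-- **`trdeg_k κ(R_P) = dim R − ht P`** when `R` is moreover LOCAL with residue field algebraic over `k` and `dim R = d`,
`ht P = h`: then `trdeg_k Frac R = d` (`trdeg_eq_of_ringKrullDim_eq_of_isAlgebraic_residueField`) and
`trdeg_k κ(R_P) + h = d`. [cite: Matsumura1987, §15 Thm 15.5–15.6 (dimension formula)] -/
theorem trdeg_residueField_atPrime_eq [IsLocalRing R] [Algebra.IsAlgebraic k (ResidueField R)]
    {d h : ℕ} (hd : ringKrullDim R = d) (hh : P.height = h) :
    Algebra.trdeg k (ResidueField Λ) = (d - h : ℕ) ∧ h ≤ d := by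
  obtain ⟨n, h', hn, hh', hsum⟩ :=
    exists_trdeg_residueField_add_height_eq (k := k) (F := FractionRing R) P (Λ := Λ)
  have hnd : Algebra.trdeg k (FractionRing R) = d :=
    trdeg_eq_of_ringKrullDim_eq_of_isAlgebraic_residueField (k := k) (S := R) (F := FractionRing R) hd
  rw [hn] at hnd
  have hnd' : n = d := by exact_mod_cast hnd
  rw [hh] at hh'
  have hhh : h = h' := by exact_mod_cast hh'
  subst hnd' hhh
  -- `trdeg_k κ(Λ)` is a natural number `m` with `m + h = n`
  have hlt : Algebra.trdeg k (ResidueField Λ) < Cardinal.aleph0 := by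
    refine lt_of_le_of_lt ?_ (Cardinal.natCast_lt_aleph0 (n := n))
    rw [← hsum]
    exact le_self_add
  obtain ⟨m, hm⟩ := Cardinal.lt_aleph0.1 hlt
  rw [hm] at hsum ⊢
  have hmn : m + h = n := by exact_mod_cast hsum
  refine ⟨?_, by omega⟩
  have : m = n - h := by omega
  rw [this]

end AtPrime

/-! ## Algebraic extensions do not change `trdeg_k`; the (A4) number -/

section Algebraic

/-- **Algebraic field extensions preserve the transcendence degree over the ground field**: for fields `k → κ → L` with
`L` algebraic over `κ` (e.g. `L = κ(√h̄₀)`), `trdeg_k L = trdeg_k κ` (`trdeg_k κ + trdeg_κ L = trdeg_k L`, `trdeg_κ L = 0`).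
[cite: Matsumura1987, Thm 5.6] -/
theorem trdeg_eq_trdeg_of_isAlgebraic {k κ L : Type u} [Field k] [Field κ] [Field L] [Algebra k κ] [Algebra κ L]
    [Algebra k L] [IsScalarTower k κ L] [Algebra.IsAlgebraic κ L] : Algebra.trdeg k L = Algebra.trdeg k κ := by
  haveI : FaithfulSMul k κ := (faithfulSMul_iff_algebraMap_injective k κ).2 (algebraMap k κ).injective
  haveI : FaithfulSMul κ L := (faithfulSMul_iff_algebraMap_injective κ L).2 (algebraMap κ L).injective
  have hadd := trdeg_add_eq k κ (A := L)
  rw [trdeg_eq_zero (R := κ) (A := L), add_zero] at hadd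
  exact hadd.symm

/-- **Transfer along an abstractly presented residue map.** If `φ : Λ → κ` is a surjective ring map onto a field, compatible
with the `k`-structures, whose kernel is the maximal ideal of the local ring `Λ` (`φ r = 0 ↔ r ∈ 𝔪_Λ`), then `κ ≅ κ(Λ)` over `k`
and `trdeg_k κ = trdeg_k κ(Λ)`. (For consumers who carry the residue field of `Λ = R_{P₀}` as a field `κ` with a map `φ`.)
[folklore] -/
theorem trdeg_eq_trdeg_residueField_of_residueMap {k Λ κ : Type u} [Field k] [CommRing Λ] [IsLocalRing Λ]
    [Algebra k Λ] [Field κ] [Algebra k κ] (φ : Λ →+* κ) (hφk : ∀ c : k, φ (algebraMap k Λ c) = algebraMap k κ c)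
    (hφ : Function.Surjective φ) (hker : ∀ r : Λ, φ r = 0 ↔ r ∈ maximalIdeal Λ) :
    Algebra.trdeg k κ = Algebra.trdeg k (ResidueField Λ) := by
  let φ' : Λ →ₐ[k] κ := { φ with commutes' := hφk }
  have hφ' : Function.Surjective φ' := hφ
  have hk : RingHom.ker φ' = maximalIdeal Λ := by
    ext r
    exact (RingHom.mem_ker).trans (hker r)
  let e₁ : (Λ ⧸ RingHom.ker φ') ≃ₐ[k] κ := Ideal.quotientKerAlgEquivOfSurjective hφ'
  let e₂ : (Λ ⧸ RingHom.ker φ') ≃ₐ[k] ResidueField Λ := Ideal.quotientEquivAlgOfEq k hk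
  exact (e₁.symm.trans e₂).trdeg_eq

variable {k R L : Type u} [Field k] [CommRing R] [IsDomain R] [IsLocalRing R] [Algebra k R]
  [Algebra.EssFiniteType k R] [Algebra.IsAlgebraic k (ResidueField R)]

/-- **`trdeg_k L = dim R − ht P`** for any field `L` algebraic over the residue field `κ(R_P)` at a prime `P` of a local
domain `R` essentially of finite type over `k` with residue field algebraic over `k`. [cite: Matsumura1987, §15 Thm 15.5–15.6 (dimension formula)] -/
theorem trdeg_eq_sub_of_isAlgebraic (P : Ideal R) [P.IsPrime] (Λ : Type u) [CommRing Λ] [Algebra R Λ]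
    [IsLocalization.AtPrime Λ P] [IsLocalRing Λ] [Algebra k Λ] [IsScalarTower k R Λ]
    [Field L] [Algebra (ResidueField Λ) L] [Algebra k L] [IsScalarTower k (ResidueField Λ) L]
    [Algebra.IsAlgebraic (ResidueField Λ) L] {d h : ℕ} (hd : ringKrullDim R = d) (hh : P.height = h) :
    Algebra.trdeg k L = (d - h : ℕ) := by
  rw [trdeg_eq_trdeg_of_isAlgebraic (k := k) (κ := ResidueField Λ) (L := L)]
  exact (trdeg_residueField_atPrime_eq (k := k) P (Λ := Λ) hd hh).1

/-- **(A4) `trdeg_k L = 2`.** For the 4-dimensional local member `R` (essentially of finite type over `k`, residue field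
algebraic over `k`), its height-2 critical prime `P₀`, the local ring `Λ = R_{P₀}` with residue field `κ(P₀)`, and any field
`L` algebraic over `κ(P₀)` (in the application `L = κ(P₀)(√h̄₀)`): `trdeg_k L = 2`. [cite: Matsumura1987, §15 Thm 15.5–15.6 (dimension formula)] -/
theorem trdeg_eq_two_of_height_two (P : Ideal R) [P.IsPrime] (Λ : Type u) [CommRing Λ] [Algebra R Λ]
    [IsLocalization.AtPrime Λ P] [IsLocalRing Λ] [Algebra k Λ] [IsScalarTower k R Λ]
    [Field L] [Algebra (ResidueField Λ) L] [Algebra k L] [IsScalarTower k (ResidueField Λ) L]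
    [Algebra.IsAlgebraic (ResidueField Λ) L] (hd : ringKrullDim R = (4 : ℕ)) (hh : P.height = 2) :
    Algebra.trdeg k L = 2 := by
  have h := trdeg_eq_sub_of_isAlgebraic (k := k) P Λ (L := L) (d := 4) (h := 2) hd (by exact_mod_cast hh)
  rw [h]
  norm_num

/-- (A4) for the residue field itself: `trdeg_k κ(P₀) = 2` (`dim R = 4`, `ht P₀ = 2`). [cite: Matsumura1987, §15 Thm 15.5–15.6 (dimension formula)] -/
theorem trdeg_residueField_eq_two_of_height_two (P : Ideal R) [P.IsPrime] (Λ : Type u) [CommRing Λ] [Algebra R Λ]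
    [IsLocalization.AtPrime Λ P] [IsLocalRing Λ] [Algebra k Λ] [IsScalarTower k R Λ]
    (hd : ringKrullDim R = (4 : ℕ)) (hh : P.height = 2) :
    Algebra.trdeg k (ResidueField Λ) = 2 := by
  have h := (trdeg_residueField_atPrime_eq (k := k) P (Λ := Λ) (d := 4) (h := 2) hd (by exact_mod_cast hh)).1
  rw [h]
  norm_num

/-- **(A4), residue field carried abstractly.** Same as `trdeg_eq_two_of_height_two`, with the residue field of `Λ = R_{P₀}`
presented as a field `κ` with a surjective `k`-compatible ring map `φ : Λ → κ` whose kernel is `𝔪_Λ`, and `L` any field algebraic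
over `κ` (e.g. `L = κ(√h̄₀)`): `trdeg_k L = 2` and `trdeg_k κ = 2`. [cite: Matsumura1987, §15 Thm 15.5–15.6 (dimension formula)] -/
theorem trdeg_eq_two_of_height_two_of_residueMap (P : Ideal R) [P.IsPrime] (Λ : Type u) [CommRing Λ] [Algebra R Λ]
    [IsLocalization.AtPrime Λ P] [IsLocalRing Λ] [Algebra k Λ] [IsScalarTower k R Λ]
    {κ : Type u} [Field κ] [Algebra k κ] (φ : Λ →+* κ) (hφk : ∀ c : k, φ (algebraMap k Λ c) = algebraMap k κ c)
    (hφ : Function.Surjective φ) (hker : ∀ r : Λ, φ r = 0 ↔ r ∈ maximalIdeal Λ)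
    [Field L] [Algebra κ L] [Algebra k L] [IsScalarTower k κ L] [Algebra.IsAlgebraic κ L]
    (hd : ringKrullDim R = (4 : ℕ)) (hh : P.height = 2) :
    Algebra.trdeg k L = 2 ∧ Algebra.trdeg k κ = 2 := by
  have hκ : Algebra.trdeg k κ = 2 := by
    rw [trdeg_eq_trdeg_residueField_of_residueMap φ hφk hφ hker]
    exact trdeg_residueField_eq_two_of_height_two (k := k) P Λ hd hh
  refine ⟨?_, hκ⟩
  rw [trdeg_eq_trdeg_of_isAlgebraic (k := k) (κ := κ) (L := L)]
  exact hκ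

end Algebraic

/-! ## v2 (append) — (42a) consumer shape of res-D-pv-012 AS res-L0-w41-stub-8 (09:43:57Z): the surface germ `A = φ(R i₀) ⊆ κ = κ(P₀)`

The 2-dimensional surface germ `A = φ(R i₀) ⊆ κ(P₀)` with `Frac A = κ(P₀)` and element-wise algebraic residue field (`hzd`):
`trdeg_k κ(P₀)(√h̄₀) = 2` in the consumer's verbatim signature `trdeg_eq_two_of_surfaceGerm`, via
`isAlgebraic_residueField_of_forall_aeval_not_isUnit` + `trdeg_eq_of_germ` (engine E2 + E5). -/

section SurfaceGerm

/-- **Residue field algebraic, element-wise form.** If every element `a` of a local `k`-algebra `A` has a non-zero polynomial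
`f ∈ k[X]` with `f(a)` a NON-unit (i.e. `f(ā) = 0` in the residue field), then the residue field `κ(A)` is algebraic over `k`
(pv-012's `hzd`, pushed forward from `ZeroDim k O`). [folklore] -/
theorem isAlgebraic_residueField_of_forall_aeval_not_isUnit {k A : Type u} [Field k] [CommRing A] [IsLocalRing A]
    [Algebra k A] (hzd : ∀ a : A, ∃ f : Polynomial k, f ≠ 0 ∧ ¬ IsUnit (Polynomial.aeval a f)) :
    Algebra.IsAlgebraic k (ResidueField A) := by
  refine ⟨fun z => ?_⟩
  obtain ⟨a, rfl⟩ := IsLocalRing.residue_surjective z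
  obtain ⟨f, hf0, hfu⟩ := hzd a
  refine ⟨f, hf0, ?_⟩
  have hcomp : algebraMap k (ResidueField A) = (residue A).comp (algebraMap k A) := by
    rw [IsScalarTower.algebraMap_eq k A (ResidueField A), ResidueField.algebraMap_eq]
  rw [Polynomial.aeval_def, hcomp, ← Polynomial.hom_eval₂, ← Polynomial.aeval_def, residue_eq_zero_iff]
  exact (IsLocalRing.mem_maximalIdeal _).mpr hfu

/-- **`trdeg_k L = dim A`** for a LOCAL `k`-subalgebra `A` of a field `κ` with `Frac A = κ`, essentially of finite type over `k`,
of dimension `d`, whose residue field is algebraic over `k` (element-wise form `hzd`), and any field `L` algebraic over `κ`: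
the engine `trdeg_eq_of_ringKrullDim_eq_of_isAlgebraic_residueField` (`trdeg_k κ = dim A`) followed by
`trdeg_eq_trdeg_of_isAlgebraic` (`trdeg_k L = trdeg_k κ`). [cite: Matsumura1987, §15 Thm 15.5–15.6 (dimension formula)] -/
theorem trdeg_eq_of_germ (k κ L : Type u) [Field k] [Field κ] [Field L] [Algebra k κ] [Algebra κ L]
    [Algebra k L] [IsScalarTower k κ L] [Algebra.IsAlgebraic κ L] (A : Subalgebra k κ) [IsFractionRing A κ]
    [IsLocalRing A] [Algebra.EssFiniteType k A] {d : ℕ} (hdim : ringKrullDim A = d)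
    (hzd : ∀ a : A, ∃ f : Polynomial k, f ≠ 0 ∧ ¬ IsUnit (Polynomial.aeval a f)) :
    Algebra.trdeg k L = d ∧ Algebra.trdeg k κ = d := by
  haveI := isAlgebraic_residueField_of_forall_aeval_not_isUnit hzd
  have hκ : Algebra.trdeg k κ = d :=
    trdeg_eq_of_ringKrullDim_eq_of_isAlgebraic_residueField (k := k) (S := A) (F := κ) hdim
  refine ⟨?_, hκ⟩
  rw [trdeg_eq_trdeg_of_isAlgebraic (k := k) (κ := κ) (L := L)]
  exact hκ

/-- **(A4) in the consumer's exact shape ((42a), res-D-pv-012 09:43:57Z, VERBATIM signature).** For the surface germ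
`A = φ(R i₀) ⊆ κ = κ(P₀)` — a local `k`-subalgebra of `κ` with `Frac A = κ`, essentially of finite type over `k`, of Krull
dimension `2`, every element of which is killed modulo `𝔪_A` by a non-zero polynomial over `k` — and `L = κ(√h̄₀)` (any field
algebraic over `κ`): `trdeg_k L = 2`. [cite: Matsumura1987, §15 Thm 15.5–15.6 (dimension formula)] -/
theorem trdeg_eq_two_of_surfaceGerm (k κ L : Type) [Field k] [Field κ] [Field L] [Algebra k κ] [Algebra κ L]
    [Algebra k L] [IsScalarTower k κ L] [Algebra.IsAlgebraic κ L] (A : Subalgebra k κ) [IsFractionRing A κ]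
    [IsLocalRing A] [Algebra.EssFiniteType k A] (hdim : ringKrullDim A = (2 : ℕ))
    (hzd : ∀ a : A, ∃ f : Polynomial k, f ≠ 0 ∧ ¬ IsUnit (Polynomial.aeval a f)) :
    Algebra.trdeg k L = 2 := by
  have h := (trdeg_eq_of_germ k κ L A hdim hzd).1
  rw [h]
  norm_num

/-- (A4) for the germ's own fraction field: `trdeg_k κ(P₀) = 2` in the consumer's shape. [cite: Matsumura1987, §15 Thm 15.5–15.6 (dimension formula)] -/
theorem trdeg_eq_two_of_surfaceGerm' (k κ : Type) [Field k] [Field κ] [Algebra k κ] (A : Subalgebra k κ)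
    [IsFractionRing A κ] [IsLocalRing A] [Algebra.EssFiniteType k A] (hdim : ringKrullDim A = (2 : ℕ))
    (hzd : ∀ a : A, ∃ f : Polynomial k, f ≠ 0 ∧ ¬ IsUnit (Polynomial.aeval a f)) :
    Algebra.trdeg k κ = 2 := by
  haveI : Algebra.IsAlgebraic κ κ := Algebra.IsAlgebraic.of_finite κ κ
  have h := (trdeg_eq_of_germ k κ κ A hdim hzd).2
  rw [h]
  norm_num

end SurfaceGerm

end Summit.ResolutionOfSingularities.ResolutionOfSingularities.Theorems.SwitchingDichotomy.LowTower

end
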